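import Summits.Ventures.PercRepro.S1CoreCapSpecSpreadFourLinesE

/-!
# PercRepro — THE INSTANCE `ν = 4` OF THE SPREAD SPEC, THIRD LEG, PART 2: THE F-LINES (p1, gen 31)

`proofs/P1-S2-CORANK6.md` §4d–§4e. With `A ∩ B = {v}`, the **F-lines** are the lines with at most one point on `A ∪ B`. A third F-line lies in
`A ∪ B ∪ F₁ ∪ F₂` (`F_third_subset`: the list `[F₃, F₂, F₁, B, A]` costs `2 + 1 + 1` before `F₃`) with exactly one point on each of `F₁`, `F₂`,
`A ∪ B`, the last its only point off `F₁ ∪ F₂` (`F_third_structure`); a fourth lies in `F₃ ∪ F₂ ∪ F₁` (`F_fourth_subset`: `[F₄, F₃, F₂, F₁]` has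
`lineRank ≤ 4`), so the third and fourth share their point `x ∈ A ∪ B` off `F₁ ∪ F₂`, and then `[F₄, F₃, F₁, C]` (`C ∈ {A, B}` the line
through `x`) has `lineRank = 4 − #(F₁ ∩ C) ≤ 4` on `8 − #(F₁ ∩ C)` points (`F_fourth_contra`): **at most three F-lines** (`F_card_le_three`).
With an E-line present, a second F-line already lies in `F₁ ∪ E ∪ (A ∪ B)` (`F_second_subset_of_E`: `[F₂, F₁, E, B, A]` costs `2 + 1 + 1`
before `F₂`) — used by the main file. Axioms: standard.
-/



namespace PercRepro

namespace S1

namespace FourCap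

variable {β : Type} [DecidableEq β]

section Lines

variable {w : β → ℕ} {ls : Finset (Finset β)}
  (hw1 : ∀ L ∈ ls, ∀ v ∈ L, w v = 1)
  (hcard : ∀ L ∈ ls, L.card = 3)
  (h3 : ∀ L ∈ ls, ∀ L' ∈ ls, L ≠ L' → (L ∩ L').card ≤ 1)
  (h4 : ∀ l : List (Finset β), l.Nodup → (∀ L ∈ l, L ∈ ls) → wsum w (unionL l) ≤ 4 + lineRank l)
  (h7 : ∀ l : List (Finset β), l.Nodup → (∀ L ∈ l, L ∈ ls) → lineRank l ≤ 4 → wsum w (unionL l) ≤ lineRank l + 3)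

include hw1 hcard h3 h4 in
/-- **A third F-line lies in the union of `A ∪ B` and the first two** (`A ∩ B = {v}`, each F-line with `≤ 1` point on `A ∪ B`):
the list `[F₃, F₂, F₁, B, A]` costs `2 + 1 + 1` before `F₃`, so `F₃` adds no new point. -/
theorem F_third_subset {A B F₁ F₂ F₃ : Finset β} (hA : A ∈ ls) (hB : B ∈ ls) (hF₁ : F₁ ∈ ls) (hF₂ : F₂ ∈ ls)
    (hF₃ : F₃ ∈ ls) (hAB : (B ∩ A).card = 1) (h1A : F₁ ≠ A) (h1B : F₁ ≠ B) (h2A : F₂ ≠ A) (h2B : F₂ ≠ B)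
    (h3A : F₃ ≠ A) (h3B : F₃ ≠ B) (h21 : F₂ ≠ F₁) (h31 : F₃ ≠ F₁) (h32 : F₃ ≠ F₂)
    (hk1 : (F₁ ∩ (B ∪ A)).card ≤ 1) (hk2 : (F₂ ∩ (B ∪ A)).card ≤ 1) :
    F₃ ⊆ F₂ ∪ (F₁ ∪ (B ∪ A)) := by
  have hBA : B ≠ A := by
    rintro rfl
    rw [Finset.inter_self, hcard B hB] at hAB
    omega
  have hw : ∀ L ∈ ls, ∀ v ∈ L, 1 ≤ w v := fun L hL v hv => by rw [hw1 L hL v hv]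
  have hc := h4 [F₃, F₂, F₁, B, A] (by simp [hBA, h1A, h1B, h2A, h2B, h3A, h3B, h21, h31, h32])
    (by simp [hA, hB, hF₁, hF₂, hF₃])
  obtain ⟨a1, b1, c1, d1⟩ := cost_step w A [] (hw A hA)
  obtain ⟨a2, b2, c2, d2⟩ := cost_step w B [A] (hw B hB)
  obtain ⟨a3, b3, c3, d3⟩ := cost_step w F₁ [B, A] (hw F₁ hF₁)
  obtain ⟨a4, b4, c4, d4⟩ := cost_step w F₂ [F₁, B, A] (hw F₂ hF₂)
  obtain ⟨a5, b5, c5, d5⟩ := cost_step w F₃ [F₂, F₁, B, A] (hw F₃ hF₃)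
  obtain ⟨e0, e1, e2, e3⟩ := cost_start w A
  -- weights `1`: the sdiff weights are cardinalities
  have w1 := wsum_sdiff_eq_card hw1 hA (unionL ([] : List (Finset β)))
  have w2 := wsum_sdiff_eq_card hw1 hB (unionL [A])
  have w3 := wsum_sdiff_eq_card hw1 hF₁ (unionL [B, A])
  have w4 := wsum_sdiff_eq_card hw1 hF₂ (unionL [F₁, B, A])
  have w5 := wsum_sdiff_eq_card hw1 hF₃ (unionL [F₂, F₁, B, A])
  have i2 : (B ∩ unionL [A]).card = 1 := by
    simp only [unionL, Finset.union_empty]; exact hAB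
  have i3 : (F₁ ∩ unionL [B, A]).card ≤ 1 := by
    simp only [unionL, Finset.union_empty]; exact hk1
  have i4 : (F₂ ∩ unionL [F₁, B, A]).card ≤ 2 := by
    simp only [unionL, Finset.union_empty]
    rw [Finset.inter_union_distrib_left]
    refine (Finset.card_union_le _ _).trans ?_
    have := h3 F₂ hF₂ F₁ hF₁ h21
    omega
  have kA := hcard A hA
  have kB := hcard B hB
  have k1 := hcard F₁ hF₁
  have k2 := hcard F₂ hF₂
  have k3 := hcard F₃ hF₃
  have hzero : (F₃ \ unionL [F₂, F₁, B, A]).card = 0 := by omega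
  have hsub : F₃ ⊆ unionL [F₂, F₁, B, A] := Finset.sdiff_eq_empty_iff_subset.1 (Finset.card_eq_zero.1 hzero)
  simpa [unionL] using hsub

include hcard h3 in
/-- **The structure of a third F-line**: inside `F₂ ∪ F₁ ∪ (B ∪ A)` with one point on each of `F₁`, `F₂`, `B ∪ A`, the point on `B ∪ A`
being its only point off `F₂ ∪ F₁`. -/
theorem F_third_structure {A B F₁ F₂ F₃ : Finset β} (hF₁ : F₁ ∈ ls) (hF₂ : F₂ ∈ ls) (hF₃ : F₃ ∈ ls)
    (h31 : F₃ ≠ F₁) (h32 : F₃ ≠ F₂) (hk3 : (F₃ ∩ (B ∪ A)).card ≤ 1) (hsub : F₃ ⊆ F₂ ∪ (F₁ ∪ (B ∪ A))) :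
    (F₃ ∩ F₁).card = 1 ∧ (F₃ ∩ F₂).card = 1 ∧ (F₃ ∩ (B ∪ A)).card = 1 ∧ (F₃ ∩ (F₂ ∪ F₁)).card = 2 ∧
      (F₃ \ (F₂ ∪ F₁)).card = 1 ∧ F₃ \ (F₂ ∪ F₁) ⊆ B ∪ A ∧ (F₃ ∩ F₂ ∩ F₁).card = 0 := by
  have i1 := h3 F₃ hF₃ F₁ hF₁ h31
  have i2 := h3 F₃ hF₃ F₂ hF₂ h32
  have k3 := hcard F₃ hF₃
  have hsplit : F₃ = (F₃ ∩ F₂) ∪ ((F₃ ∩ F₁) ∪ (F₃ ∩ (B ∪ A))) := by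
    rw [← Finset.inter_union_distrib_left, ← Finset.inter_union_distrib_left]
    exact (Finset.inter_eq_left.2 hsub).symm
  have hle : F₃.card ≤ (F₃ ∩ F₂).card + ((F₃ ∩ F₁).card + (F₃ ∩ (B ∪ A)).card) := by
    calc F₃.card = ((F₃ ∩ F₂) ∪ ((F₃ ∩ F₁) ∪ (F₃ ∩ (B ∪ A)))).card := by rw [← hsplit]
      _ ≤ (F₃ ∩ F₂).card + ((F₃ ∩ F₁) ∪ (F₃ ∩ (B ∪ A))).card := Finset.card_union_le _ _
      _ ≤ (F₃ ∩ F₂).card + ((F₃ ∩ F₁).card + (F₃ ∩ (B ∪ A)).card) :=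
          Nat.add_le_add_left (Finset.card_union_le _ _) _
  have hsd : F₃ \ (F₂ ∪ F₁) ⊆ B ∪ A := by
    intro x hx
    rw [Finset.mem_sdiff] at hx
    have := hsub hx.1
    rw [Finset.mem_union, Finset.mem_union] at this
    rw [Finset.mem_union] at hx
    tauto
  have hsdle : (F₃ \ (F₂ ∪ F₁)).card ≤ 1 := by
    refine (Finset.card_le_card (show F₃ \ (F₂ ∪ F₁) ⊆ F₃ ∩ (B ∪ A) from ?_)).trans hk3
    intro x hx
    exact Finset.mem_inter.2 ⟨(Finset.mem_sdiff.1 hx).1, hsd hx⟩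
  have hdist : F₃ ∩ (F₂ ∪ F₁) = (F₃ ∩ F₂) ∪ (F₃ ∩ F₁) := Finset.inter_union_distrib_left F₃ F₂ F₁
  have hui := Finset.card_union_add_card_inter (F₃ ∩ F₂) (F₃ ∩ F₁)
  have hii : (F₃ ∩ F₂) ∩ (F₃ ∩ F₁) = F₃ ∩ F₂ ∩ F₁ := by
    ext x; simp only [Finset.mem_inter]; tauto
  rw [hii] at hui
  have hsi := Finset.card_sdiff_add_card_inter F₃ (F₂ ∪ F₁)
  rw [hdist] at hsi
  have hle2 : ((F₃ ∩ F₂) ∪ (F₃ ∩ F₁)).card ≤ (F₃ ∩ F₂).card + (F₃ ∩ F₁).card := Finset.card_union_le _ _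
  refine ⟨by omega, by omega, by omega, ?_, by omega, hsd, by omega⟩
  rw [hdist]; omega

include hw1 hcard h3 h7 in
/-- **A fourth F-line lies in the union of the first three** (the list `[F₄, F₃, F₂, F₁]` has `lineRank ≤ 4`). -/
theorem F_fourth_subset {A B F₁ F₂ F₃ F₄ : Finset β} (hF₁ : F₁ ∈ ls) (hF₂ : F₂ ∈ ls) (hF₃ : F₃ ∈ ls) (hF₄ : F₄ ∈ ls)
    (h21 : F₂ ≠ F₁) (h31 : F₃ ≠ F₁) (h32 : F₃ ≠ F₂) (h41 : F₄ ≠ F₁) (h42 : F₄ ≠ F₂) (h43 : F₄ ≠ F₃)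
    (hk3 : (F₃ ∩ (B ∪ A)).card ≤ 1) (hk4 : (F₄ ∩ (B ∪ A)).card ≤ 1)
    (hsub3 : F₃ ⊆ F₂ ∪ (F₁ ∪ (B ∪ A))) (hsub4 : F₄ ⊆ F₂ ∪ (F₁ ∪ (B ∪ A))) :
    F₄ ⊆ F₃ ∪ (F₂ ∪ F₁) := by
  obtain ⟨-, -, -, s3, t3, -, -⟩ := F_third_structure hcard h3 hF₁ hF₂ hF₃ h31 h32 hk3 hsub3
  obtain ⟨-, -, -, s4, -, -, -⟩ := F_third_structure hcard h3 hF₁ hF₂ hF₄ h41 h42 hk4 hsub4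
  have hw : ∀ L ∈ ls, ∀ v ∈ L, 1 ≤ w v := fun L hL v hv => by rw [hw1 L hL v hv]
  have hsp := h7 [F₄, F₃, F₂, F₁] (by simp [h21, h31, h32, h41, h42, h43]) (by simp [hF₁, hF₂, hF₃, hF₄])
  obtain ⟨a1, b1, c1, d1⟩ := cost_step w F₁ [] (hw F₁ hF₁)
  obtain ⟨a2, b2, c2, d2⟩ := cost_step w F₂ [F₁] (hw F₂ hF₂)
  obtain ⟨a3, b3, c3, d3⟩ := cost_step w F₃ [F₂, F₁] (hw F₃ hF₃)
  obtain ⟨a4, b4, c4, d4⟩ := cost_step w F₄ [F₃, F₂, F₁] (hw F₄ hF₄)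
  obtain ⟨e0, e1, e2, e3⟩ := cost_start w F₁
  have w1 := wsum_sdiff_eq_card hw1 hF₁ (unionL ([] : List (Finset β)))
  have w2 := wsum_sdiff_eq_card hw1 hF₂ (unionL [F₁])
  have w3 := wsum_sdiff_eq_card hw1 hF₃ (unionL [F₂, F₁])
  have w4 := wsum_sdiff_eq_card hw1 hF₄ (unionL [F₃, F₂, F₁])
  have i2 : (F₂ ∩ unionL [F₁]).card ≤ 1 := by
    simp only [unionL, Finset.union_empty]; exact h3 F₂ hF₂ F₁ hF₁ h21
  have i3 : (F₃ ∩ unionL [F₂, F₁]).card = 2 := by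
    simp only [unionL, Finset.union_empty]; exact s3
  have j3 : (F₃ \ unionL [F₂, F₁]).card = 1 := by
    simp only [unionL, Finset.union_empty]; exact t3
  have i4 : 2 ≤ (F₄ ∩ unionL [F₃, F₂, F₁]).card := by
    simp only [unionL, Finset.union_empty]
    rw [← s4]
    exact Finset.card_le_card (Finset.inter_subset_inter_left Finset.subset_union_right)
  have k1 := hcard F₁ hF₁
  have k2 := hcard F₂ hF₂
  have k3 := hcard F₃ hF₃
  have k4 := hcard F₄ hF₄
  have hr : lineRank [F₄, F₃, F₂, F₁] ≤ 4 := by omega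
  have hsp' := hsp hr
  rw [wsum_unionL_eq_card hw1 _ (by simp [hF₁, hF₂, hF₃, hF₄])] at hsp'
  have hzero : (F₄ \ unionL [F₃, F₂, F₁]).card = 0 := by omega
  have hsub : F₄ ⊆ unionL [F₃, F₂, F₁] := Finset.sdiff_eq_empty_iff_subset.1 (Finset.card_eq_zero.1 hzero)
  simpa [unionL] using hsub

include hw1 hcard h3 h7 in
/-- **The contradiction of a fourth F-line**: the third and fourth F-lines share their point `x ∈ C` (`C` = `A` or `B`) off `F₂ ∪ F₁`;
the list `[F₄, F₃, F₁, C]` has `lineRank = 4 − #(F₁ ∩ C) ≤ 4` (`F₃`, `F₄` add no rank: `x` and their `F₁`-points) but its union has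
`8 − #(F₁ ∩ C)` points (their `F₂`-points are new and distinct). -/
theorem F_fourth_contra {C F₁ F₂ F₃ F₄ : Finset β} {x : β} (hC : C ∈ ls) (hF₁ : F₁ ∈ ls)
    (hF₃ : F₃ ∈ ls) (hF₄ : F₄ ∈ ls) (h1C : F₁ ≠ C) (h3C : F₃ ≠ C) (h4C : F₄ ≠ C) (h31 : F₃ ≠ F₁) (h41 : F₄ ≠ F₁)
    (h43 : F₄ ≠ F₃) (hxC : x ∈ C) (hx3 : F₃ \ (F₂ ∪ F₁) = {x}) (hx4 : F₄ \ (F₂ ∪ F₁) = {x})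
    (i31 : (F₃ ∩ F₁).card = 1) (i32 : (F₃ ∩ F₂).card = 1) (z3 : (F₃ ∩ F₂ ∩ F₁).card = 0)
    (i41 : (F₄ ∩ F₁).card = 1) (i42 : (F₄ ∩ F₂).card = 1) (z4 : (F₄ ∩ F₂ ∩ F₁).card = 0) : False := by
  have hw : ∀ L ∈ ls, ∀ v ∈ L, 1 ≤ w v := fun L hL v hv => by rw [hw1 L hL v hv]
  -- the point `x`
  have hx3' := Finset.mem_sdiff.1 (hx3 ▸ Finset.mem_singleton_self x)
  have hx4' := Finset.mem_sdiff.1 (hx4 ▸ Finset.mem_singleton_self x)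
  rw [Finset.mem_union] at hx3' hx4'
  have hxF₃ : x ∈ F₃ := hx3'.1
  have hxF₄ : x ∈ F₄ := hx4'.1
  have hxF₁ : x ∉ F₁ := fun h => hx3'.2 (Or.inr h)
  have hxF₂ : x ∉ F₂ := fun h => hx3'.2 (Or.inl h)
  -- the `F₂`-points `z₃`, `z₄`
  obtain ⟨z₃, hz₃⟩ := Finset.card_eq_one.1 i32
  obtain ⟨z₄, hz₄⟩ := Finset.card_eq_one.1 i42
  have hz₃' := Finset.mem_inter.1 (hz₃ ▸ Finset.mem_singleton_self z₃)
  have hz₄' := Finset.mem_inter.1 (hz₄ ▸ Finset.mem_singleton_self z₄)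
  have hz₃F₁ : z₃ ∉ F₁ := fun h => by
    have : z₃ ∈ F₃ ∩ F₂ ∩ F₁ := Finset.mem_inter.2 ⟨Finset.mem_inter.2 hz₃', h⟩
    rw [Finset.card_eq_zero.1 z3] at this
    simp at this
  have hz₄F₁ : z₄ ∉ F₁ := fun h => by
    have : z₄ ∈ F₄ ∩ F₂ ∩ F₁ := Finset.mem_inter.2 ⟨Finset.mem_inter.2 hz₄', h⟩
    rw [Finset.card_eq_zero.1 z4] at this
    simp at this
  have hxz₃ : x ≠ z₃ := fun h => hxF₂ (h ▸ hz₃'.2)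
  have hxz₄ : x ≠ z₄ := fun h => hxF₂ (h ▸ hz₄'.2)
  have hz₃C : z₃ ∉ C := fun h =>
    hxz₃ (Finset.card_le_one.1 (h3 F₃ hF₃ C hC h3C) x (Finset.mem_inter.2 ⟨hxF₃, hxC⟩) z₃
      (Finset.mem_inter.2 ⟨hz₃'.1, h⟩))
  have hz₄C : z₄ ∉ C := fun h =>
    hxz₄ (Finset.card_le_one.1 (h3 F₄ hF₄ C hC h4C) x (Finset.mem_inter.2 ⟨hxF₄, hxC⟩) z₄
      (Finset.mem_inter.2 ⟨hz₄'.1, h⟩))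
  have hz₄F₃ : z₄ ∉ F₃ := fun h => by
    have hz : z₄ = z₃ := by
      have : z₄ ∈ F₃ ∩ F₂ := Finset.mem_inter.2 ⟨h, hz₄'.2⟩
      rw [hz₃] at this
      exact Finset.mem_singleton.1 this
    have hsub : ({x, z₃} : Finset β) ⊆ F₄ ∩ F₃ := by
      intro y hy
      simp only [Finset.mem_insert, Finset.mem_singleton] at hy
      rcases hy with rfl | rfl
      · exact Finset.mem_inter.2 ⟨hxF₄, hxF₃⟩
      · exact Finset.mem_inter.2 ⟨hz ▸ hz₄'.1, hz₃'.1⟩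
    have := Finset.card_le_card hsub
    rw [Finset.card_pair hxz₃] at this
    have := h3 F₄ hF₄ F₃ hF₃ h43
    omega
  -- the list `[F₄, F₃, F₁, C]`
  have hsp := h7 [F₄, F₃, F₁, C] (by simp [h1C, h3C, h4C, h31, h41, h43]) (by simp [hC, hF₁, hF₃, hF₄])
  obtain ⟨a1, b1, c1, d1⟩ := cost_step w C [] (hw C hC)
  obtain ⟨a2, b2, c2, d2⟩ := cost_step w F₁ [C] (hw F₁ hF₁)
  obtain ⟨a3, b3, c3, d3⟩ := cost_step w F₃ [F₁, C] (hw F₃ hF₃)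
  obtain ⟨a4, b4, c4, d4⟩ := cost_step w F₄ [F₃, F₁, C] (hw F₄ hF₄)
  obtain ⟨e0, e1, e2, e3⟩ := cost_start w C
  have w1 := wsum_sdiff_eq_card hw1 hC (unionL ([] : List (Finset β)))
  have w2 := wsum_sdiff_eq_card hw1 hF₁ (unionL [C])
  have w3 := wsum_sdiff_eq_card hw1 hF₃ (unionL [F₁, C])
  have w4 := wsum_sdiff_eq_card hw1 hF₄ (unionL [F₃, F₁, C])
  have i2 : (F₁ ∩ unionL [C]).card ≤ 1 := by
    simp only [unionL, Finset.union_empty]; exact h3 F₁ hF₁ C hC h1C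
  have i3 : 2 ≤ (F₃ ∩ unionL [F₁, C]).card := by
    simp only [unionL, Finset.union_empty]
    have hsub : (F₃ ∩ F₁) ∪ {x} ⊆ F₃ ∩ (F₁ ∪ C) := by
      intro y hy
      rw [Finset.mem_union, Finset.mem_singleton] at hy
      rcases hy with hy | rfl
      · exact Finset.mem_inter.2 ⟨(Finset.mem_inter.1 hy).1, Finset.mem_union_left _ (Finset.mem_inter.1 hy).2⟩
      · exact Finset.mem_inter.2 ⟨hxF₃, Finset.mem_union_right _ hxC⟩
    have hdisj : Disjoint (F₃ ∩ F₁) {x} := by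
      rw [Finset.disjoint_singleton_right]
      exact fun h => hxF₁ (Finset.mem_inter.1 h).2
    have := Finset.card_le_card hsub
    rw [Finset.card_union_of_disjoint hdisj, i31, Finset.card_singleton] at this
    exact this
  have i4 : 2 ≤ (F₄ ∩ unionL [F₃, F₁, C]).card := by
    simp only [unionL, Finset.union_empty]
    have hsub : (F₄ ∩ F₁) ∪ {x} ⊆ F₄ ∩ (F₃ ∪ (F₁ ∪ C)) := by
      intro y hy
      rw [Finset.mem_union, Finset.mem_singleton] at hy
      rcases hy with hy | rfl
      · exact Finset.mem_inter.2 ⟨(Finset.mem_inter.1 hy).1,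
          Finset.mem_union_right _ (Finset.mem_union_left _ (Finset.mem_inter.1 hy).2)⟩
      · exact Finset.mem_inter.2 ⟨hxF₄, Finset.mem_union_left _ hxF₃⟩
    have hdisj : Disjoint (F₄ ∩ F₁) {x} := by
      rw [Finset.disjoint_singleton_right]
      exact fun h => hxF₁ (Finset.mem_inter.1 h).2
    have := Finset.card_le_card hsub
    rw [Finset.card_union_of_disjoint hdisj, i41, Finset.card_singleton] at this
    exact this
  have n3 : 1 ≤ (F₃ \ unionL [F₁, C]).card := by
    simp only [unionL, Finset.union_empty]
    refine Finset.card_pos.2 ⟨z₃, Finset.mem_sdiff.2 ⟨hz₃'.1, ?_⟩⟩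
    rw [Finset.mem_union]; tauto
  have n4 : 1 ≤ (F₄ \ unionL [F₃, F₁, C]).card := by
    simp only [unionL, Finset.union_empty]
    refine Finset.card_pos.2 ⟨z₄, Finset.mem_sdiff.2 ⟨hz₄'.1, ?_⟩⟩
    rw [Finset.mem_union, Finset.mem_union]; tauto
  have kC := hcard C hC
  have k1 := hcard F₁ hF₁
  have k3 := hcard F₃ hF₃
  have k4 := hcard F₄ hF₄
  have hr : lineRank [F₄, F₃, F₁, C] ≤ 4 := by omega
  have hsp' := hsp hr
  rw [wsum_unionL_eq_card hw1 _ (by simp [hC, hF₁, hF₃, hF₄])] at hsp'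
  omega

include hw1 hcard h3 h4 h7 in
/-- **At most three F-lines** (`A ∩ B = {v}`). -/
theorem F_card_le_three {A B : Finset β} (hA : A ∈ ls) (hB : B ∈ ls) (hAB : (B ∩ A).card = 1) :
    (ls.filter (fun L => L ≠ A ∧ L ≠ B ∧ (L ∩ (B ∪ A)).card ≤ 1)).card ≤ 3 := by
  by_contra hlt
  push Not at hlt
  set 𝓕 := ls.filter (fun L => L ≠ A ∧ L ≠ B ∧ (L ∩ (B ∪ A)).card ≤ 1) with h𝓕
  obtain ⟨F₁, F₂, F₃, h1, h2, h3', h12, h13, h23⟩ := Finset.two_lt_card_iff.1 (by omega : 2 < 𝓕.card)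
  have h2' : F₂ ∈ (𝓕.erase F₁) := Finset.mem_erase.2 ⟨h12.symm, h2⟩
  have h3'' : F₃ ∈ (𝓕.erase F₁).erase F₂ := Finset.mem_erase.2 ⟨h23.symm, Finset.mem_erase.2 ⟨h13.symm, h3'⟩⟩
  have hpos : 0 < (((𝓕.erase F₁).erase F₂).erase F₃).card := by
    rw [Finset.card_erase_of_mem h3'', Finset.card_erase_of_mem h2', Finset.card_erase_of_mem h1]
    omega
  obtain ⟨F₄, hF₄⟩ := Finset.card_pos.1 hpos
  simp only [Finset.mem_erase] at hF₄
  obtain ⟨h43, h42, h41, hm4⟩ := hF₄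
  rw [h𝓕, Finset.mem_filter] at h1 h2 h3' hm4
  have sub3 := F_third_subset hw1 hcard h3 h4 hA hB h1.1 h2.1 h3'.1 hAB h1.2.1 h1.2.2.1 h2.2.1 h2.2.2.1
    h3'.2.1 h3'.2.2.1 h12.symm h13.symm h23.symm h1.2.2.2 h2.2.2.2
  have sub4 := F_third_subset hw1 hcard h3 h4 hA hB h1.1 h2.1 hm4.1 hAB h1.2.1 h1.2.2.1 h2.2.1 h2.2.2.1
    hm4.2.1 hm4.2.2.1 h12.symm h41 h42 h1.2.2.2 h2.2.2.2
  obtain ⟨i31, i32, -, -, t3, sd3, z3⟩ := F_third_structure hcard h3 h1.1 h2.1 h3'.1 h13.symm h23.symm h3'.2.2.2 sub3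
  obtain ⟨i41, i42, -, -, t4, -, z4⟩ := F_third_structure hcard h3 h1.1 h2.1 hm4.1 h41 h42 hm4.2.2.2 sub4
  have sub4' := F_fourth_subset hw1 hcard h3 h7 h1.1 h2.1 h3'.1 hm4.1 h12.symm h13.symm h23.symm h41 h42 h43
    h3'.2.2.2 hm4.2.2.2 sub3 sub4
  obtain ⟨x, hx⟩ := Finset.card_eq_one.1 t3
  have hx4 : F₄ \ (F₂ ∪ F₁) = {x} := by
    have hsub : F₄ \ (F₂ ∪ F₁) ⊆ F₃ \ (F₂ ∪ F₁) := by
      intro y hy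
      rw [Finset.mem_sdiff] at hy ⊢
      have := sub4' hy.1
      rw [Finset.mem_union] at this
      exact ⟨this.resolve_right hy.2, hy.2⟩
    rw [hx] at hsub
    exact Finset.eq_of_subset_of_card_le hsub (by rw [t4, Finset.card_singleton])
  have hxBA : x ∈ B ∪ A := sd3 (hx ▸ Finset.mem_singleton_self x)
  rw [Finset.mem_union] at hxBA
  rcases hxBA with hxB | hxA
  · exact F_fourth_contra hw1 hcard h3 h7 hB h1.1 h3'.1 hm4.1 h1.2.2.1 h3'.2.2.1 hm4.2.2.1 h13.symm h41 h43
      hxB hx hx4 i31 i32 z3 i41 i42 z4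
  · exact F_fourth_contra hw1 hcard h3 h7 hA h1.1 h3'.1 hm4.1 h1.2.1 h3'.2.1 hm4.2.1 h13.symm h41 h43
      hxA hx hx4 i31 i32 z3 i41 i42 z4

include hw1 hcard h3 h4 in
/-- **With an E-line present, a second F-line lies in the union of `A ∪ B`, the E-line and the first F-line**: the list
`[F₂, F₁, E, B, A]` costs `2 + 1 + 1` before `F₂`. -/
theorem F_second_subset_of_E {A B E F₁ F₂ : Finset β} (hA : A ∈ ls) (hB : B ∈ ls) (hE : E ∈ ls) (hF₁ : F₁ ∈ ls)
    (hF₂ : F₂ ∈ ls) (hAB : (B ∩ A).card = 1) (hEA : E ≠ A) (hEB : E ≠ B) (h1A : F₁ ≠ A) (h1B : F₁ ≠ B) (h2A : F₂ ≠ A)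
    (h2B : F₂ ≠ B) (h1E : F₁ ≠ E) (h2E : F₂ ≠ E) (h21 : F₂ ≠ F₁) (hk : (E ∩ (B ∪ A)).card = 2)
    (hk1 : (F₁ ∩ (B ∪ A)).card ≤ 1) : F₂ ⊆ F₁ ∪ (E ∪ (B ∪ A)) := by
  have hBA : B ≠ A := by
    rintro rfl
    rw [Finset.inter_self, hcard B hB] at hAB
    omega
  have hw : ∀ L ∈ ls, ∀ v ∈ L, 1 ≤ w v := fun L hL v hv => by rw [hw1 L hL v hv]
  have hc := h4 [F₂, F₁, E, B, A] (by simp [hBA, hEA, hEB, h1A, h1B, h2A, h2B, h1E, h2E, h21])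
    (by simp [hA, hB, hE, hF₁, hF₂])
  obtain ⟨a1, b1, c1, d1⟩ := cost_step w A [] (hw A hA)
  obtain ⟨a2, b2, c2, d2⟩ := cost_step w B [A] (hw B hB)
  obtain ⟨a3, b3, c3, d3⟩ := cost_step w E [B, A] (hw E hE)
  obtain ⟨a4, b4, c4, d4⟩ := cost_step w F₁ [E, B, A] (hw F₁ hF₁)
  obtain ⟨a5, b5, c5, d5⟩ := cost_step w F₂ [F₁, E, B, A] (hw F₂ hF₂)
  obtain ⟨e0, e1, e2, e3⟩ := cost_start w A
  have w1 := wsum_sdiff_eq_card hw1 hA (unionL ([] : List (Finset β)))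
  have w2 := wsum_sdiff_eq_card hw1 hB (unionL [A])
  have w3 := wsum_sdiff_eq_card hw1 hE (unionL [B, A])
  have w4 := wsum_sdiff_eq_card hw1 hF₁ (unionL [E, B, A])
  have w5 := wsum_sdiff_eq_card hw1 hF₂ (unionL [F₁, E, B, A])
  have i2 : (B ∩ unionL [A]).card = 1 := by
    simp only [unionL, Finset.union_empty]; exact hAB
  have i3 : (E ∩ unionL [B, A]).card = 2 := by
    simp only [unionL, Finset.union_empty]; exact hk
  have i4 : (F₁ ∩ unionL [E, B, A]).card ≤ 2 := by
    simp only [unionL, Finset.union_empty]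
    rw [Finset.inter_union_distrib_left]
    refine (Finset.card_union_le _ _).trans ?_
    have := h3 F₁ hF₁ E hE h1E
    omega
  have kA := hcard A hA
  have kB := hcard B hB
  have kE := hcard E hE
  have k1 := hcard F₁ hF₁
  have k2 := hcard F₂ hF₂
  have hzero : (F₂ \ unionL [F₁, E, B, A]).card = 0 := by omega
  have hsub : F₂ ⊆ unionL [F₁, E, B, A] := Finset.sdiff_eq_empty_iff_subset.1 (Finset.card_eq_zero.1 hzero)
  simpa [unionL] using hsub

end Lines

end FourCap

end S1

end PercRepro
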